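import Mathlib
import HarnessLib
import HarnessLib.Audit
import Summits.BirchSwinnertonDyer.Statement
import Summits.BirchSwinnertonDyer.Rank1Residual.F1Sign2.AnalyticLineTransferAtTwo
import Summits.BirchSwinnertonDyer.BirchSwinnertonDyer.Theorems.Rank1ResidualX1Defs
import Summits.BirchSwinnertonDyer.Rank1Residual.WAll.TargetAtTwoThetaSlices
import HarnessLib.Audit.Status.Attr

/-!
Route: AlignedTransportAtTwo

# Route AlignedTransportAtTwo — 2-adic Mazur main conjecture transported along ALIGNED mod-2
congruences from BSD-known rank-0 seeds to rank-one curves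

It suffices to show X = C1 ∧ C2 ∧ C3 ∧ R for the registered leaf `WAllNonCMAtTwoOffThetaHabitat`
(rung W-ALL/1.offhab: BSD(E,2) for every
non-CM E/ℚ of analytic rank ≤ 1 off the theta habitat). The ATTACKED conjunct is the ALIGNED-SEED
CELL: E non-CM, r_an(E) = 1, good ORDINARY at 2,
no rational 2-torsion, non-square discriminant (mod-2 image S₃), admitting a PARTNER E′ (non-CM,
good ordinary at 2, S₃ image, r_an(E′) = 0,
BSD(E′,2) known, analytic μ₂(E′) = 0) whose 2-division cubic has a root in the same cubic field F as
E's, the two roots being ALIGNED AT 2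
(`AlignedAtTwo`) and AT ∞ (`AlignedAtInfinity`). On the cell: C2 (seed: rank-0 BSD(E′,2) ⇒ Mazur's
2-adic main conjecture for E′), C1
(aligned transport: main conjecture for E′ ⇒ main conjecture for E), C3 (descent: main conjecture +
r_an = 1 ⇒ BSD(E,2)). Off the cell: the
declared residual R (the leaf restricted to the complement, imported, not attacked).
Lean:
`Summit.BirchSwinnertonDyer.BirchSwinnertonDyer.Theses.AlignedTransportAtTwo.MainConjectureTransportAlignedAtTwo
∧
Summit.BirchSwinnertonDyer.BirchSwinnertonDyer.Theses.AlignedTransportAtTwo.MainConjectureOfRankZeroBSDAtTwo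
∧
Summit.BirchSwinnertonDyer.BirchSwinnertonDyer.Theses.AlignedTransportAtTwo.BSDOfMainConjectureRankOneAtTwo
∧
Summit.BirchSwinnertonDyer.BirchSwinnertonDyer.Theses.AlignedTransportAtTwo.OffAlignedSeedCellAtTwo`

## Assembly
Pure logic (excluded middle on the cell predicate, file glue.lean, theorem `closes`, kernel-checked
in Sketch.lean): given W non-CM with
r_an(W) ≤ 1 off the theta habitat, either W lies in the aligned-seed cell — then its partner W′ gets
the main conjecture from C2 (seed), W gets it
from C1 (aligned transport, all alignment / ordinarity / torsion / μ hypotheses being cell data),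
and C3 turns it into BSD(W,2) using r_an(W) = 1 —
or W lies off the cell and R applies verbatim. No Assembly
item beyond the mandatory one below is filed (D-0027: `closes` is the deciding theorem and proves
exactly the Assembly statement).

CLOSES_TARGET: closes rung W-ALL/1.offhab of BirchSwinnertonDyer: Summit.BirchSwinnertonDyer.WAllNonCMAtTwoOffThetaHabitat (D-0061; not the summit Statement) — the deciding theorem of this route concludes that registered leaf instead of the Statement decl `BirchSwinnertonDyer` (class rung: servable and labelled, never counted as concluding the summit Statement).

Rationale: WHY THIS LINE. Greenberg–Vatsal (GreenbergVatsal2000, Thm 1.4) and Emerton–Pollack–Weston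
(EmertonPollackWeston2006, Thm 1) transport Mazur's main conjecture
along a congruence E₁[p] ≅ E₂[p] at an odd ordinary prime: μ = 0 and the main conjecture for E₁ give
them for E₂ once the algebraic and analytic
λ-invariants change by the SAME local sums. At p = 2 the naive transfer is FALSE (431a1 ~ 431b1:
analytic λ 6 vs 2, cell bsd-f1-sign2 MEMO-imc §3);
the cell's censuses (kit j286203/j286212, 8 005 semistable-at-2 congruent pairs: 6 232/6 232 aligned
pairs obey the corrected law, 0/1 773
misaligned ones do, REF1 §26) isolate the missing hypothesis: the two curves' 2-division fields must
be identified THROUGH THE SAME CUBIC ROOT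
2-adically and at the real place (ALIGNMENT, tree decls `AlignedAtTwo`/`AlignedAtInfinity`, typed
law `AnalyticLineTransferAtTwo`, p553953).
The line imports cyclotomic Iwasawa theory (Kato2004Asterisque Thm 17.4 (1)(2), valid at p = 2;
Greenberg1999 control), the GV/EPW
invariant calculus, computer-assisted BSD in rank 0 as SEEDS (CreutzMiller2012/Miller2011: bsd.S31,
N < 5000) and 2-adic Gross–Zagier /
Schneider descent for the last step (PerrinRiou1987, Schneider1985, Kobayashi2013,
BurungaleTian2026). What no prior route does: route
ThetaPartnerAtTwo transports at 2 only from CM theta partners at SUPERSINGULAR 2 in rank 0;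
SmallImageMuTransfer transports μ at p ≥ 5 on
class X9; ByReductionTypeAtTwo.RankOneAtTwo has no mechanism. Here the seed is any BSD-certified
rank-0 non-CM curve, the prime is the
ORDINARY prime 2, the target is rank ONE, and the alignment law is the new typed input.

RANKED CRUXES. #2 MainConjectureTransportAlignedAtTwo (crux) — for W₁, W₂/ℚ globally minimal, both
good ordinary at 2, both without rational 2-torsion, Δ(W₂) non-square, sharing a cubic field F =
ℚ(e₁) = ℚ(e₂) generated by roots of their 2-division cubics with e₁, e₂ ALIGNED at 2 and at ∞, and
with analytic μ₂(W₁) = 0 on the even branch: Mazur's 2-adic main conjecture for W₁ implies Mazur's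
2-adic main conjecture for W₂ (GV Thm 1.4 / EPW Thm 1 at p = 2 under alignment). [difficulty: XL]
(why it might fail: GV/EPW need μ_alg = 0 to transport and Kato's divisibility IN Λ (Thm 17.4 (3))
excludes p = 2 — only 17.4 (2) (Λ⊗ℚ, λ-part) holds at 2, so a 2-power ambiguity char X = 2^k·(L₂)
must be killed on BOTH sides (the algebraic aligned transfer itself is Matsuno 2008 Thm 4.2, in
print at p = 2).) [GreenbergVatsal2000, EmertonPollackWeston2006, Kato2004Asterisque, Greenberg1999,
Matsuno2008]
#3 BSDOfMainConjectureRankOneAtTwo (crux) — for W/ℚ non-CM, globally minimal, good ordinary at 2, no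
rational 2-torsion, Δ non-square, analytic rank 1: Mazur's 2-adic main conjecture for W implies the
2-part of BSD for W (2-adic Gross–Zagier + Schneider's leading-term formula + Kato/Kolyvagin
finiteness at p = 2). [difficulty: XL] (why it might fail: the printed descents (Perrin-Riou 1987,
Schneider 1985, Kobayashi 2013, Burungale–Tian) assume p odd; at 2 the leading term needs the 2-adic
cyclotomic height of the generator ≠ 0 (Schneider's conjecture, open) and the factors #Ẽ(𝔽₂)²,
Tamagawa 2-parts enter the unit comparison.) [PerrinRiou1987, Schneider1985, Kobayashi2013,
BurungaleTian2026, MazurSteinTate2006, Greenberg1999]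
#4 MainConjectureOfRankZeroBSDAtTwo (crux) — for W/ℚ non-CM, globally minimal, good ordinary at 2,
no rational 2-torsion, Δ non-square, analytic rank 0, analytic μ₂ = 0 on the even branch: the 2-part
of BSD for W implies Mazur's 2-adic main conjecture for W (the SEED: Kato's divisibility 17.4 (2) +
Greenberg control at T = 0 + the BSD₂ unit equation force equality of characteristic ideals).
[difficulty: L] (why it might fail: Kato 17.4 (3) (divisibility in Λ under 12.5.2) prints «Assume
further p ≠ 2»; with only 17.4 (2) the μ-part of char X is free, so the seed needs μ_alg(W) = 0 at 2
(Greenberg's μ-conjecture for E[2] irreducible, open) besides μ_an = 0; control at 2 carries the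
factor (1 − α⁻¹)² ∈ 4ℤ₂.) [Kato2004Asterisque, Greenberg1999, CreutzMiller2012, Miller2011,
GrigorovJorzaPatrikisSteinTarnita2009, SkinnerUrban2014]
#5 OffAlignedSeedCellAtTwo (crux) — RESIDUAL (declared, imported, not attacked): the leaf
`WAllNonCMAtTwoOffThetaHabitat` restricted to the complement of the aligned-seed cell — BSD(W,2) for
every non-CM W of analytic rank ≤ 1 off the theta habitat that is NOT [rank 1 ∧ good ordinary at 2 ∧
no rational 2-torsion ∧ Δ non-square ∧ has an aligned BSD₂-known μ-trivial rank-0 partner].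
[difficulty: open-problem] (why it might fail: it contains BSD₂ for rank ≤ 1 non-CM curves
supersingular / multiplicative / additive at 2, with rational 2-torsion, or without an aligned seed
— summit-hard strata (e.g. additive-at-2 rank 1) with no printed mechanism at 2.)
[Kato2004Asterisque, BurungaleSkinnerTianWan2024, CastellaGrossiSkinner2025, Disegni2017]

TWO-LAYER PLAN. C1 ⇐ (A) analytic aligned transfer on the ordinary stratum [the tree law
`AnalyticLineTransferAtTwo` restricted to good ordinary pairs: λ_an and
μ_an = 0 move along aligned congruences with the local sums Σ s_ℓ] → (B) algebraic aligned transfer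
= IN PRINT: Matsuno 2008 Thm 4.2 + Cor 2.3
[Matsuno2008 p. 413: X Λ-torsion ∧ μ = 0 ⇒ same for E′ and λ^{Σ₀} equal, under exactly the alignment
conditions at v ∣ 2 and v ∈ Σ_+; REF2 v15] → (K) Kato 17.4 (1)(2) at p = 2 closes the equality; C3 ⇐
2-adic p-converse
(r_an = 1 ⇒ corank 1, Ш[2^∞] finite: Kato + Gross–Zagier–Kolyvagin, in tree) → 2-adic leading-term
formula (Schneider/Perrin-Riou shape at 2 with
explicit anomalous factor) ; C2 ⇐ control theorem at 2 (Greenberg 1999 §4 with #Ẽ(𝔽₂) factors) →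
μ_alg = 0 on the seed list (per-curve, decidable
by 2-descent over the first layer ℚ(√2)) → unit equation. None filed now.

KILL CRITERIA. Refuted C1 (an aligned ordinary pair at 2 with main conjecture known on one side and
failing on the other, or — cheaper — an aligned good-ordinary
S₃ pair violating the λ-law (A): census kit j286203/j286212 found 0 such among 6 232) closes the
route `refuted:MainConjectureTransportAlignedAtTwo`.
Refuted C2 by a rank-0 seed with BSD₂ true and μ_alg(2) > 0 forces a pivot to seeds with CERTIFIED
μ_alg = 0 (restate C2 with that hypothesis).
A proof of `ByReductionTypeAtTwo.RankOneAtTwo` (stmt-19099) or of K4 `Rank1Residual.NonCMAtTwo`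
elsewhere moots the route. If the census
D-imc-10 (kit j288979/j289309) shows > 3 aligned copies per maximal ideal at odd S₃ levels, the
alignment law's mechanism (H12♯) is wrong and C1
loses its evidence base (pivot to the SigmaR symbol-line law, REF1 §26 Part C).

NOT DECOMPOSED YET. (The algebraic half of C1 is decomposed IN PRINT — Matsuno 2008 Thm 4.2 + Cor
2.3 — and is ALREADY A TREE FACT:
`Literature.NumberTheory.EllipticCurves.matsuno2008_thm42_transport_two_lines`
(LambdaInvariantCongruenceTransportAtTwo.lean; root-map typing of the line conditions, conclusion
over `SelmerDualData`); what the route needs there is only a typing BRIDGE (support, size M):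
`AlignedAtTwo` ∧ `AlignedAtInfinity` over `twoDivisionUCubic` ⇒ Matsuno's line hypotheses. Its
analytic twin is displayed, never asserted, as hypothesis `hTan` of
Theorems/TwoAdicConverseLambdaHalfAnalyticTransport.lean — that display is C1's stub (A) in
Néron-normalised λ form.) The identification of Kato's X with Greenberg/Matsuno's X₂ at 2 including
the real-place condition (H¹(ℝ, E[2^∞]) ≅ ℤ/2 iff Δ > 0), the exact 2-adic unit bookkeeping in C2/C3
((1 − α⁻¹)², Tamagawa 2-parts, #E(ℚ)[2^∞] = 1
on the cell, Manin constant odd by Abbes–Ullmo), the ϖ-normalisation of `MazurMainConjecture` versus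
the plus period, and the per-seed μ_alg = 0
certificates are layer-2 children, to be split only after a crux closes or a prover asks (D-0019).

CHEAPEST FALSIFIER. The analytic shadow of C1 on real data: for every aligned good-ordinary-at-2 S₃
congruent pair in the census (kit j286203 ALIGN2B/ALIGN3, 6 232
aligned semistable pairs of which the good-ordinary sub-table is the C1 regime) check λ_an(W₂) −
λ_an(W₁) = Σ_ℓ (s_ℓ(W₂) − s_ℓ(W₁)) on the even
branch and μ_an = 0 on both sides; RUN: 0 violations among the aligned pairs, 1 773/1 773 misaligned
pairs violate the unaligned form (REF1 §26,
MEMO-imc §10.2x). Next cheapest: one seed W′ (N′ < 5000, rank 0, ordinary at 2, S₃) with μ_alg(2) >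
0 detected by 2-descent over ℚ(√2) kills C2 as typed.

NUMBERS. Census (cell bsd-f1-sign2, tables with sha16 in HOME/MEMO-imc-data): congruent
semistable-at-2 pairs N ≤ 10⁴: 8 005; aligned 6 232 (law holds
6 232/6 232); misaligned 1 773 (naive law fails 1 773/1 773); first refuting pair of the UNALIGNED
transfer 431a1 ~ 431b1 (λ_an 6 vs 2). Seeds:
bsd.S31 gives BSD(E′,p) for all p for every E′ with N′ < 5000 and r_an ≤ 1 (16 725 curves;
CreutzMiller2012 Thm 1.1). Kato 17.4: (1),(2) all p;
(3) p ≠ 2 only.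

DEFINITION REQUESTS. D1 (later, not blocking): a NON-junk canonical cyclotomic 2-adic height datum
`PAdicHeightData W 2` with `IsCanonical` at p = 2 (the tree's
`cyclotomicPAdicHeight W 2` is the zero/junk datum:
`not_schneiderConjecture_cyclotomicPAdicHeight_two`), so that C3 can later be cut by a
decidable non-degeneracy hypothesis. Cite facts wanted: Kato 17.4 (2) at p = 2 as a named fact over
`SelmerDualData` (statement-only).

Novelty: Searches (2026-08-27): lit search --hybrid "Iwasawa invariants congruent elliptic curves p = 2"
(hits: GreenbergVatsal2000, EmertonPollackWeston2006 — both p odd), lit search "main conjecture p=2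
elliptic curve ordinary" (Kato2004Asterisque Thm 17.4; no p = 2 transport), lit galaxy search
"Iwasawa invariants|congruent elliptic|mu-invariant" --star all (GV, EPW, Matsuno — Matsuno 2008 Thm
4.2 [corpus:paper:matsuno2008 p0011 L22–39] IS the ALGEBRAIC aligned transfer at p = 2 with exactly
our two alignment clauses; no hit for the ANALYTIC / main-conjecture transport at 2), lit vsearch
"lambda invariants of 2-adic L-functions of congruent elliptic curves differ" (Kilford–Wiese
multiplicity papers arXiv:math/0612317, arXiv:math/0612318; Kedlaya–Medvedovsky arXiv:1806.04653
Conj 13), lean search 'MazurMainConjecture' (tree: Rank1ResidualX1Defs, SmallImageMuTransfer asides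
GreenbergVatsal2000.thm14_mainConjecture_transfer_of_torsionIso /
EmertonPollackWeston2006.thm1_muAn_transfer_of_torsionIso, both typed for odd p), ledger negatives
--problem BirchSwinnertonDyer (AnalyticMuZeroMultAtTwo refuted-misstated p548567; no aligned
statement refuted).
Nearest prior art found: Matsuno2008 Thm 4.2 + Cor 2.3 (the algebraic Selmer-side aligned transfer
at p = 2 — verbatim our (B); IN TREE as the named fact
`Literature.NumberTheory.EllipticCurves.matsuno2008_thm42_transport_two_lines`
(LambdaInvariantCongruenceTransportAtTwo.lean, root-map typing of the two line conditions) — and its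
ANALYTIC  [refs: math/0612317, math/0612318, 1806.04653, paper:matsuno2008, GreenbergVatsal2000, EmertonPollackWeston2006, Matsuno2008]

Barriers (technique_class: iwasawa-main-conjecture, congruence-transport, padic-GZ): - technique_class: iwasawa-main-conjecture, congruence-transport, mu-lambda-invariants,
p-adic-gross-zagier
- Literature.Barriers.BirchSwinnertonDyer.EulerSystemBigImageBarrier: outside — the cell has
SURJECTIVE mod-2 image (S₃ = GL₂(𝔽₂): no rational 2-torsion ∧ Δ non-square), so Kato's 12.5.2-type
hypotheses are not vacuous here; what bites instead is Kato's explicit exclusion of p = 2 in 17.4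
(3), carried as the why-might-fail of C1/C2 (only 17.4 (1)(2) are used).
- Literature.Barriers.BirchSwinnertonDyer.PAdicHeightBarrier: C3 sits INSIDE this class (main
conjecture ⇒ BSD in rank one reads the leading term through the 2-adic height); it does not evade
it; the bet is that on the cell (r_an = 1, Heegner point available) the 2-adic Gross–Zagier value
computes h₂(y_K) so non-degeneracy becomes a per-curve decidable input, to be added as a hypothesis
once D1 is typed.
- Literature.Barriers.BirchSwinnertonDyer.SignedIwasawaTheoryAtTwoBarrier: outside — the cell is
good ORDINARY at 2 (no signed/♯♭ objects); the supersingular-at-2 curves are in the declared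
residual R.
- Literature.Barriers.BirchSwinnertonDyer.AdditiveIwasawaTheoryAtTwoBarrier: outside — additive-at-2
curves are in the residual R, not in any attacked crux.
- Literature.Barriers.BirchSwinnertonDyer.ExceptionalZeroBarrierNarrow: outside — every attacked
crux is at a prime of GOOD ORDINARY reduction (`IsOrdinaryAt W 2`), so no Mazur–Tate–Teitelbaum
split-multiplicative trivial zero enters; the even-branch lifts are `

History (route lifecycle, newest last):
- 2026-08-27T21:53:40Z · rev 2: restated OffAlignedSeedCellAtTwo (stmt-BirchSwinnertonDyer-22299) — tribunal round-1 retarget (i), step A of 2: cell predicate of the residual and of closes gains the simple-zero clause ord_T L₂ = 1 (typed on padicLFunction f (u (planner-bsd-f1-sign2-imc-g3-0)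
- 2026-08-27T21:59:25Z · rev 3: restated BSDOfMainConjectureRankOneAtTwo (stmt-BirchSwinnertonDyer-22297) — tribunal round-1 retarget (i), step B of 2: C3 gains the hypothesis ord_T L₂(f_E) = 1 (J: «C3′ = C3 + hypothesis ord_T L₂ = 1, typable now»); decl name kept so (planner-bsd-f1-sign2-imc-g3-0)

sub-problem: BirchSwinnertonDyer · status: open · opened planner-bsd-f1-sign2-imc-g3-0 2026-08-27T20:42:25Z · rev 5 · ledger route-BirchSwinnertonDyer-AlignedTransportAtTwo
GENERATED by the gate from the ledger (D-0016/17). Provers cite these decls: `theorem foo : Summit.BirchSwinnertonDyer.BirchSwinnertonDyer.Theses.AlignedTransportAtTwo.<Decl> := …` in Summits/BirchSwinnertonDyer/BirchSwinnertonDyer/Theorems/<Name>.lean.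
-/

namespace Summit.BirchSwinnertonDyer.BirchSwinnertonDyer.Theses.AlignedTransportAtTwo

open scoped BigOperators Topology Manifold Classical MeasureTheory ProbabilityTheory Matrix InnerProductSpace ComplexConjugate ContinuousMap
open Filter Set Function TopologicalSpace MeasureTheory

attribute [summit_statement] _root_.BirchSwinnertonDyer
attribute [summit_statement] _root_.Summit.BirchSwinnertonDyer.WAllNonCMAtTwoOffThetaHabitat

open Literature

/-- item stmt-BirchSwinnertonDyer-22296 · crux · rank 2 · open · by planner
why it might fail: GV/EPW need μ_alg = 0 to transport and Kato's divisibility IN Λ (Thm 17.4 (3)) excludes p = 2 — only 17.4 (2) (Λ⊗ℚ, λ-part) holds at 2, so a 2-power ambiguity char X = 2^k·(L₂) must be killed on BOTH sides (the algebraic aligned transfer itself is Matsuno 2008 Thm 4.2, in print at p = 2).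
sources: GreenbergVatsal2000, EmertonPollackWeston2006, Kato2004Asterisque, Greenberg1999, Matsuno2008
[crux] for W₁, W₂/ℚ globally minimal, both good ordinary at 2, both without rational 2-torsion,
Δ(W₂) non-square, sharing a cubic field F = ℚ(e₁) = ℚ(e₂) generated by roots of their 2-division
cubics with e₁, e₂ ALIGNED at 2 and at ∞, and with analytic μ₂(W₁) = 0 on the even branch: Mazur's
2-adic main conjecture for W₁ implies Mazur's 2-adic main conjecture for W₂ (GV Thm 1.4 / EPW Thm 1
at p = 2 under alignment). [difficulty: XL] -/
@[route_item "route-BirchSwinnertonDyer-AlignedTransportAtTwo", crux]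
def MainConjectureTransportAlignedAtTwo : Prop :=
  ∀ (W₁ : WeierstrassCurve ℚ) [W₁.IsElliptic] [W₁.IsGloballyMinimal] (W₂ : WeierstrassCurve ℚ) [W₂.IsElliptic] [W₂.IsGloballyMinimal], Literature.NumberTheory.EllipticCurves.IsOrdinaryAt W₁ 2 → Literature.NumberTheory.EllipticCurves.IsOrdinaryAt W₂ 2 → (∀ x : ℚ, ¬ Literature.NumberTheory.EllipticCurves.Greenberg1999.HasRationalTwoTorsionX W₁ x) → (∀ x : ℚ, ¬ Literature.NumberTheory.EllipticCurves.Greenberg1999.HasRationalTwoTorsionX W₂ x) → ¬ IsSquare W₂.Δ → ∀ (F : Type) [Field F] [NumberField F], Module.finrank ℚ F = 3 → ∀ e₁ e₂ : F, Polynomial.aeval e₁ (Summit.BirchSwinnertonDyer.Rank1Residual.F1Sign2.twoDivisionUCubic W₁) = 0 → Polynomial.aeval e₂ (Summit.BirchSwinnertonDyer.Rank1Residual.F1Sign2.twoDivisionUCubic W₂) = 0 → Summit.BirchSwinnertonDyer.Rank1Residual.F1Sign2.AlignedAtTwo F e₁ e₂ → Summit.BirchSwinnertonDyer.Rank1Residual.F1Sign2.AlignedAtInfinity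 F (Summit.BirchSwinnertonDyer.Rank1Residual.F1Sign2.twoDivisionUCubic W₁) (Summit.BirchSwinnertonDyer.Rank1Residual.F1Sign2.twoDivisionUCubic W₂) e₁ e₂ → (∀ ⦃N₁ : ℕ⦄ [NeZero N₁] (f₁ : CuspForm (CongruenceSubgroup.Gamma0 N₁) 2), Literature.NumberTheory.EllipticCurves.ModularForms.IsNewformOf W₁ f₁ → ∀ G₁ : Literature.NumberTheory.EllipticCurves.IwasawaAlgebra 2, Summit.BirchSwinnertonDyer.Rank1Residual.F1Sign2.IsEvenBranchLiftAtTwo W₁ f₁ G₁ → Summit.BirchSwinnertonDyer.Rank1Residual.X1.MuLambda.red G₁ ≠ 0) → Summit.BirchSwinnertonDyer.BirchSwinnertonDyer.Theorems.Rank1ResidualX1Defs.MazurMainConjecture W₁ 2 → Summit.BirchSwinnertonDyer.BirchSwinnertonDyer.Theorems.Rank1ResidualX1Defs.MazurMainConjecture W₂ 2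

-- earlier BSDOfMainConjectureRankOneAtTwo (stmt-BirchSwinnertonDyer-22297, replaced 2026-08-27T21:59:25Z -> stmt-BirchSwinnertonDyer-23008): retired by None — ∀ (W : WeierstrassCurve ℚ) [W.IsElliptic] [W.IsGloballyMinimal], ¬ W.HasCM → Literature.NumberTheory.EllipticCurves.IsOrdinaryAt W 2 → (∀ x : ℚ, ¬ Literature.NumberTheory.EllipticCurves.Greenberg1999.HasRationalTwoTorsionX W x) → ¬ IsSquare W.
/-- item stmt-BirchSwinnertonDyer-23008 · crux · rank 3 · open · by planner
why it might fail: Schneider's leading-term formula, Perrin-Riou's p-adic Gross–Zagier and Disegni's Thm B are printed for p odd / p ∤ 2N; at p = 2 the height normalisation (log_p vs 4-adic branch), the Euler factor (1−1/α)² at 2 and the Manin constant may leave a power of 2 undetermined.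
sources: PerrinRiou1987, Schneider1985, Disegni2017, Kobayashi2013, MazurSteinTate2006
[crux, rank 3 — RETARGETED per tribunal round 1 (J 21:27:24Z, option (i))] BSD(E,2) for cell curves
(non-CM, good ordinary at 2, E(ℚ)[2] = 0, Δ ∉ ℚ², r_an = 1) from Mazur's 2-adic main conjecture
GIVEN a SIMPLE zero of the 2-adic L-function of the conductor-level newform at T = 0 (ord_T
L₂(f_E,T) = 1, typed on padicLFunction f (unitRoot W 2) exactly as in MazurMainConjecture). Line:
order transfer ι g = ϖ·L₂ with ϖ·Ω_E = Ω_f⁺ ≠ 0 ⇒ algebraic simple zero of char X(E/ℚ_∞) ⇒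
Schneider–Perrin-Riou leading term at p = 2 (the 2-adic height is then FORCED non-degenerate and
Ш[2^∞] finite — the Schneider content is a hypothesis, no longer proved here: outside
PAdicHeightBarrier) + 2-adic Gross–Zagier (Disegni 2017 Thm B read at p = 2) + the 2-part of the
Gross–Zagier–Kolyvagin index ⇒ BSD₂. The multiple-zero locus moved into the declared residual
OffAlignedSeedCellAtTwo (cell predicate ∧ ord_T L₂ = 1). -/
@[route_item "route-BirchSwinnertonDyer-AlignedTransportAtTwo", crux]
def BSDOfMainConjectureRankOneAtTwo : Prop :=
  ∀ (W : WeierstrassCurve ℚ) [W.IsElliptic] [W.IsGloballyMinimal], ¬ W.HasCM → Literature.NumberTheory.EllipticCurves.IsOrdinaryAt W 2 → (∀ x : ℚ, ¬ Literature.NumberTheory.EllipticCurves.Greenberg1999.HasRationalTwoTorsionX W x) → ¬ IsSquare W.Δ → W.analyticRank = 1 → (∀ [NeZero (W.conductorNorm ℤ)] (f : CuspForm (CongruenceSubgroup.Gamma0 (W.conductorNorm ℤ)) 2), Literature.NumberTheory.EllipticCurves.ModularForms.IsNewformOf W f → (Literature.NumberTheory.EllipticCurves.padicLFunction f (Literature.NumberTheory.EllipticCurves.unitRoot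 W 2 : ℚ_[2])).order = 1) → Summit.BirchSwinnertonDyer.BirchSwinnertonDyer.Theorems.Rank1ResidualX1Defs.MazurMainConjecture W 2 → Literature.NumberTheory.EllipticCurves.BSDp W 2

/-- item stmt-BirchSwinnertonDyer-22298 · crux · rank 4 · open · by planner
why it might fail: Kato 17.4 (3) (divisibility in Λ under 12.5.2) prints «Assume further p ≠ 2»; with only 17.4 (2) the μ-part of char X is not pinned by L₂(0) ≠ 0 unit information alone — the rank-0 seed may need μ_alg = 0 as an extra input at 2.
sources: Kato2004Asterisque, Greenberg1999, CreutzMiller2012, Miller2011, GrigorovJorzaPatrikisSteinTarnita2009, SkinnerUrban2014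
[crux] for W/ℚ non-CM, globally minimal, good ordinary at 2, no rational 2-torsion, Δ non-square,
analytic rank 0, analytic μ₂ = 0 on the even branch: the 2-part of BSD for W implies Mazur's 2-adic
main conjecture for W (the SEED: Kato's divisibility 17.4 (2) + Greenberg control at T = 0 + the
BSD₂ unit equation force equality of characteristic ideals). [difficulty: L] -/
@[route_item "route-BirchSwinnertonDyer-AlignedTransportAtTwo", crux (bottleneck := idea) (source := "director BSD l.276, 2026-09-01")]
def MainConjectureOfRankZeroBSDAtTwo : Prop :=
  ∀ (W : WeierstrassCurve ℚ) [W.IsElliptic] [W.IsGloballyMinimal], ¬ W.HasCM → Literature.NumberTheory.EllipticCurves.IsOrdinaryAt W 2 → (∀ x : ℚ, ¬ Literature.NumberTheory.EllipticCurves.Greenberg1999.HasRationalTwoTorsionX W x) → ¬ IsSquare W.Δ → W.analyticRank = 0 → (∀ ⦃N : ℕ⦄ [NeZero N] (f : CuspForm (CongruenceSubgroup.Gamma0 N) 2), Literature.NumberTheory.EllipticCurves.ModularForms.IsNewformOf W f → ∀ G : Literature.NumberTheory.EllipticCurves.IwasawaAlgebra 2, Summit.BirchSwinnertonDyer.Rank1Residual.F1Sign2.IsEvenBranchLiftAtTwo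 W f G → Summit.BirchSwinnertonDyer.Rank1Residual.X1.MuLambda.red G ≠ 0) → Literature.NumberTheory.EllipticCurves.BSDp W 2 → Summit.BirchSwinnertonDyer.BirchSwinnertonDyer.Theorems.Rank1ResidualX1Defs.MazurMainConjecture W 2

-- earlier OffAlignedSeedCellAtTwo (stmt-BirchSwinnertonDyer-22299, replaced 2026-08-27T21:53:40Z -> stmt-BirchSwinnertonDyer-22996): retired by None — ∀ (W : WeierstrassCurve ℚ) [W.IsElliptic] [W.IsGloballyMinimal], ¬ W.HasCM → W.analyticRank ≤ 1 → ¬ (W.analyticRank = 0 ∧ Literature.NumberTheory.EllipticCurves.Rank1Residual.GoodSS W 2 ∧ W.frobeniusTrace 2 = 0 ∧ ∃ (A : WeierstrassCurve ℚ) (_ : A.IsEl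
/-- item stmt-BirchSwinnertonDyer-22996 · crux · rank 5 · open · by planner
why it might fail: It is the untouched complement (supersingular or non-aligned or no certified seed or multiple zero of L₂): BSD₂ is open there; it is imported (declared residual), never staffed by this route.
sources: KolyvaginLogachev1989, Matsuno2008, Kato2004Asterisque, Disegni2017
[residual, declared] the leaf WAllNonCMAtTwoOffThetaHabitat OFF the aligned-seed SIMPLE-ZERO cell
(cell = r_an(W) = 1, good ordinary at 2, no rational 2-torsion, Δ non-square, ord_T L₂(f_W, T) = 1
for the conductor-level newform, and an aligned BSD₂-certified non-CM rank-0 seed W′ with μ₂(W′) =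
0). Tribunal round-1 retarget (i) (J 21:27:24Z): the Schneider / 2-adic-height locus (rank-1 cell
curves whose 2-adic L-function has a multiple zero at T = 0 — conjecturally empty) now lies in this
declared residual, not in C3. -/
@[route_item "route-BirchSwinnertonDyer-AlignedTransportAtTwo", crux]
def OffAlignedSeedCellAtTwo : Prop :=
  ∀ (W : WeierstrassCurve ℚ) [W.IsElliptic] [W.IsGloballyMinimal], ¬ W.HasCM → W.analyticRank ≤ 1 → ¬ (W.analyticRank = 0 ∧ Literature.NumberTheory.EllipticCurves.Rank1Residual.GoodSS W 2 ∧ W.frobeniusTrace 2 = 0 ∧ ∃ (A : WeierstrassCurve ℚ) (_ : A.IsElliptic) (_ : A.IsGloballyMinimal), A.HasCM ∧ A.analyticRank = 0 ∧ Literature.NumberTheory.EllipticCurves.Rank1Residual.GoodSS A 2 ∧ A.frobeniusTrace 2 = 0 ∧ ∃ e : WeierstrassCurve.geomTorsion W (2 : ℤ) ≃+ WeierstrassCurve.geomTorsion A (2 : ℤ), ∀ (σ : Field.absoluteGaloisGroup ℚ) (P : WeierstrassCurve.geomTorsion W (2 : ℤ)), e (σ • P) = σ • e P) → ¬ (W.analyticRank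 = 1 ∧ Literature.NumberTheory.EllipticCurves.IsOrdinaryAt W 2 ∧ (∀ x : ℚ, ¬ Literature.NumberTheory.EllipticCurves.Greenberg1999.HasRationalTwoTorsionX W x) ∧ ¬ IsSquare W.Δ ∧ (∀ [NeZero (W.conductorNorm ℤ)] (f : CuspForm (CongruenceSubgroup.Gamma0 (W.conductorNorm ℤ)) 2), Literature.NumberTheory.EllipticCurves.ModularForms.IsNewformOf W f → (Literature.NumberTheory.EllipticCurves.padicLFunction f (Literature.NumberTheory.EllipticCurves.unitRoot W 2 : ℚ_[2])).order = 1) ∧ ∃ (W' : WeierstrassCurve ℚ) (_ : W'.IsElliptic) (_ : W'.IsGloballyMinimal), ¬ W'.HasCM ∧ Literature.NumberTheory.EllipticCurves.IsOrdinaryAt W' 2 ∧ (∀ x : ℚ, ¬ Literature.NumberTheory.EllipticCurves.Greenberg1999.HasRationalTwoTorsionX W' x) ∧ ¬ IsSquare W'.Δ ∧ W'.analyticRank = 0 ∧ Literature.NumberTheory.EllipticCurves.BSDp W' 2 ∧ (∀ ⦃N' : ℕ⦄ [NeZero N'] (f' : CuspForm (CongruenceSubgroup.Gamma0 N') 2),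 Literature.NumberTheory.EllipticCurves.ModularForms.IsNewformOf W' f' → ∀ G' : Literature.NumberTheory.EllipticCurves.IwasawaAlgebra 2, Summit.BirchSwinnertonDyer.Rank1Residual.F1Sign2.IsEvenBranchLiftAtTwo W' f' G' → Summit.BirchSwinnertonDyer.Rank1Residual.X1.MuLambda.red G' ≠ 0) ∧ ∃ (F : Type) (_ : Field F) (_ : NumberField F), Module.finrank ℚ F = 3 ∧ ∃ e' e : F, Polynomial.aeval e' (Summit.BirchSwinnertonDyer.Rank1Residual.F1Sign2.twoDivisionUCubic W') = 0 ∧ Polynomial.aeval e (Summit.BirchSwinnertonDyer.Rank1Residual.F1Sign2.twoDivisionUCubic W) = 0 ∧ Summit.BirchSwinnertonDyer.Rank1Residual.F1Sign2.AlignedAtTwo F e' e ∧ Summit.BirchSwinnertonDyer.Rank1Residual.F1Sign2.AlignedAtInfinity F (Summit.BirchSwinnertonDyer.Rank1Residual.F1Sign2.twoDivisionUCubic W') (Summit.BirchSwinnertonDyer.Rank1Residual.F1Sign2.twoDivisionUCubic W) e' e) → Literature.NumberTheory.EllipticCurves.BSDp W 2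

/-- item stmt-BirchSwinnertonDyer-23028 · support · rank 9 · closed · proved by Summit.BirchSwinnertonDyer.BirchSwinnertonDyer.Theorems.AlignedTransportAtTwoBridge.alignedTypingBridgeAtTwo_proof (prover) · by planner
[support] TYPING BRIDGE for C1 (size M): the F1Sign2 alignment hypotheses (E(ℚ)[2] = 0; cubic field
F of degree 3; roots e, e′ of twoDivisionUCubic W, W′; AlignedAtTwo F e e′; AlignedAtInfinity) imply
the three root-map clauses of the tree fact
Literature.NumberTheory.EllipticCurves.matsuno2008_thm42_transport_two_lines (∃ q₀ q₁ q₂ : ℚ with θ′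
= q₀ + q₁θ + q₂θ² on roots of ψ = 4θ³ + b₂θ² + 2b₄θ + b₆: complex-root clause ∧ (Δ < 0 ∨
least-real-root clause) ∧ (Δ ∉ 4^k·(1 mod 8) ∨ 2-adic valuation clause)). With it, the ALGEBRAIC
half of C1 (λ-line transport at 2) is the tree fact by name; elaborates rc 0
(route/bridge/BridgeSketch.lean). Sources: Matsuno2008 Thm 4.2 + Cor 2.3;
F1Sign2/AnalyticLineTransferAtTwo.lean. -/
@[route_item "route-BirchSwinnertonDyer-AlignedTransportAtTwo"]
def AlignedTypingBridgeAtTwo : Prop :=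
  ∀ (W W' : WeierstrassCurve ℚ), (∀ x : ℚ, ¬ Literature.NumberTheory.EllipticCurves.Greenberg1999.HasRationalTwoTorsionX W x) → ∀ (F : Type) [Field F] [NumberField F], Module.finrank ℚ F = 3 → ∀ e e' : F, Polynomial.aeval e (Summit.BirchSwinnertonDyer.Rank1Residual.F1Sign2.twoDivisionUCubic W) = 0 → Polynomial.aeval e' (Summit.BirchSwinnertonDyer.Rank1Residual.F1Sign2.twoDivisionUCubic W') = 0 → Summit.BirchSwinnertonDyer.Rank1Residual.F1Sign2.AlignedAtTwo F e e' → Summit.BirchSwinnertonDyer.Rank1Residual.F1Sign2.AlignedAtInfinity F (Summit.BirchSwinnertonDyer.Rank1Residual.F1Sign2.twoDivisionUCubic W) (Summit.BirchSwinnertonDyer.Rank1Residual.F1Sign2.twoDivisionUCubic W') e e' → ∃ q₀ q₁ q₂ : ℚ, (∀ θ : ℂ, 4 * θ ^ 3 + (W.b₂ : ℂ) * θ ^ 2 + 2 * (W.b₄ : ℂ) * θ + (W.b₆ : ℂ) = 0 → 4 * ((q₀ : ℂ) + q₁ * θ + q₂ * θ ^ 2) ^ 3 + (W'.b₂ : ℂ)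 * ((q₀ : ℂ) + q₁ * θ + q₂ * θ ^ 2) ^ 2 + 2 * (W'.b₄ : ℂ) * ((q₀ : ℂ) + q₁ * θ + q₂ * θ ^ 2) + (W'.b₆ : ℂ) = 0) ∧ (W.Δ < 0 ∨ ∀ θ : ℝ, 4 * θ ^ 3 + (W.b₂ : ℝ) * θ ^ 2 + 2 * (W.b₄ : ℝ) * θ + (W.b₆ : ℝ) = 0 → (∀ r : ℝ, 4 * r ^ 3 + (W.b₂ : ℝ) * r ^ 2 + 2 * (W.b₄ : ℝ) * r + (W.b₆ : ℝ) = 0 → θ ≤ r) → ∀ r : ℝ, 4 * r ^ 3 + (W'.b₂ : ℝ) * r ^ 2 + 2 * (W'.b₄ : ℝ) * r + (W'.b₆ : ℝ) = 0 → (q₀ : ℝ) + q₁ * θ + q₂ * θ ^ 2 ≤ r) ∧ ((∀ (k : ℕ) (u : ℤ), W.Δ = (4 : ℚ) ^ k * u → u % 8 ≠ 1) ∨ ∀ θ : ℚ_[2], 4 * θ ^ 3 + (W.b₂ : ℚ_[2]) * θ ^ 2 + 2 * (W.b₄ : ℚ_[2]) * θ + (W.b₆ : ℚ_[2]) = 0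 → θ.valuation < 0 → ((q₀ : ℚ_[2]) + q₁ * θ + q₂ * θ ^ 2).valuation < 0)

-- `AlignedTypingBridgeAtTwo` holds: proved by `Summit.BirchSwinnertonDyer.BirchSwinnertonDyer.Theorems.AlignedTransportAtTwoBridge.alignedTypingBridgeAtTwo_proof` (its module imports this route file, so no `_holds` link can be stated here).

/-- item stmt-BirchSwinnertonDyer-22300 · assembly · rank 1 · closed · proved by Summit.BirchSwinnertonDyer.BirchSwinnertonDyer.Theorems.alignedTransportAtTwo_assembly_proof (prover) · by planner
sources: GreenbergVatsal2000, Kato2004Asterisque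
[assembly] MainConjectureTransportAlignedAtTwo → MainConjectureOfRankZeroBSDAtTwo →
BSDOfMainConjectureRankOneAtTwo → OffAlignedSeedCellAtTwo → the leaf WAllNonCMAtTwoOffThetaHabitat
(theorem `closes`, glue.lean). -/
@[route_item "route-BirchSwinnertonDyer-AlignedTransportAtTwo"]
def Assembly : Prop :=
  MainConjectureTransportAlignedAtTwo → MainConjectureOfRankZeroBSDAtTwo → BSDOfMainConjectureRankOneAtTwo → OffAlignedSeedCellAtTwo → Summit.BirchSwinnertonDyer.WAllNonCMAtTwoOffThetaHabitat

-- `Assembly` holds: proved by `Summit.BirchSwinnertonDyer.BirchSwinnertonDyer.Theorems.alignedTransportAtTwo_assembly_proof` (its module imports this route file, so no `_holds` link can be stated here).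

/-! D-0027 §2.1 — DECIDING THEOREM (planner-authored via `route open/edit --closes-file`; by planner-bsd-f1-sign2-imc-g3-0 2026-08-27T21:59:25Z):
its hypotheses are this route's items and its conclusion the registered leaf `Summit.BirchSwinnertonDyer.WAllNonCMAtTwoOffThetaHabitat` (rung W-ALL/1.offhab, D-0061) (glue_lint), and it elaborates with this file. -/

-- Route AlignedTransportAtTwo (cell bsd-f1-sign2, planner -imc g3) — deciding theorem, rev 2/3 (tribunal round-1 retarget (i): the cell predicate
-- carries the simple-zero clause ord_T L_2(f_E, T) = 1; on the cell: seed (h2) → aligned transport (h1) → rank-one descent given a simple zero (h3); off the cell: the declared residual hR).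
@[closes "route-BirchSwinnertonDyer-AlignedTransportAtTwo"] theorem closes (h1 : MainConjectureTransportAlignedAtTwo) (h2 : MainConjectureOfRankZeroBSDAtTwo)
    (h3 : BSDOfMainConjectureRankOneAtTwo) (hR : OffAlignedSeedCellAtTwo) :
    Summit.BirchSwinnertonDyer.WAllNonCMAtTwoOffThetaHabitat := by
  intro W _ _ hcm hr hoff
  by_cases hc : (W.analyticRank = 1 ∧ Literature.NumberTheory.EllipticCurves.IsOrdinaryAt W 2 ∧
        (∀ x : ℚ, ¬ Literature.NumberTheory.EllipticCurves.Greenberg1999.HasRationalTwoTorsionX W x) ∧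
        ¬ IsSquare W.Δ ∧
        (∀ [NeZero (W.conductorNorm ℤ)] (f : CuspForm (CongruenceSubgroup.Gamma0 (W.conductorNorm ℤ)) 2),
        Literature.NumberTheory.EllipticCurves.ModularForms.IsNewformOf W f →
        (Literature.NumberTheory.EllipticCurves.padicLFunction f
          (Literature.NumberTheory.EllipticCurves.unitRoot W 2 : ℚ_[2])).order = 1) ∧
        ∃ (W' : WeierstrassCurve ℚ) (_ : W'.IsElliptic) (_ : W'.IsGloballyMinimal),
          ¬ W'.HasCM ∧ Literature.NumberTheory.EllipticCurves.IsOrdinaryAt W' 2 ∧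
          (∀ x : ℚ, ¬ Literature.NumberTheory.EllipticCurves.Greenberg1999.HasRationalTwoTorsionX W' x) ∧
          ¬ IsSquare W'.Δ ∧ W'.analyticRank = 0 ∧ Literature.NumberTheory.EllipticCurves.BSDp W' 2 ∧
          (∀ ⦃N' : ℕ⦄ [NeZero N'] (f' : CuspForm (CongruenceSubgroup.Gamma0 N') 2),
              Literature.NumberTheory.EllipticCurves.ModularForms.IsNewformOf W' f' →
              ∀ G' : Literature.NumberTheory.EllipticCurves.IwasawaAlgebra 2,
                Summit.BirchSwinnertonDyer.Rank1Residual.F1Sign2.IsEvenBranchLiftAtTwo W' f' G' →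
                Summit.BirchSwinnertonDyer.Rank1Residual.X1.MuLambda.red G' ≠ 0) ∧
          ∃ (F : Type) (_ : Field F) (_ : NumberField F), Module.finrank ℚ F = 3 ∧
            ∃ e' e : F,
              Polynomial.aeval e' (Summit.BirchSwinnertonDyer.Rank1Residual.F1Sign2.twoDivisionUCubic W') = 0 ∧
              Polynomial.aeval e (Summit.BirchSwinnertonDyer.Rank1Residual.F1Sign2.twoDivisionUCubic W) = 0 ∧
              Summit.BirchSwinnertonDyer.Rank1Residual.F1Sign2.AlignedAtTwo F e' e ∧
              Summit.BirchSwinnertonDyer.Rank1Residual.F1Sign2.AlignedAtInfinity F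
                (Summit.BirchSwinnertonDyer.Rank1Residual.F1Sign2.twoDivisionUCubic W')
                (Summit.BirchSwinnertonDyer.Rank1Residual.F1Sign2.twoDivisionUCubic W) e' e)
  · obtain ⟨hr1, hord, ht, hsq, hSZ, W', i1, i2, hcm', hord', ht', hsq', hr0', hbsd', hmu', F, iF, iNF, hF,
      e', e, he', he, hal, hali⟩ := hc
    exact h3 W hcm hord ht hsq hr1 hSZ
      (h1 W' W hord' hord ht' ht hsq F hF e' e he' he hal hali hmu' (h2 W' hcm' hord' ht' hsq' hr0' hmu' hbsd'))
  · exact hR W hcm hr hoff hc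

end Summit.BirchSwinnertonDyer.BirchSwinnertonDyer.Theses.AlignedTransportAtTwo
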